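import Summits.Ventures.QEC.Census.CSS.K1LP16
import Summits.Ventures.QEC.Census.CSS.K1LP16CertsB7
import Summits.Ventures.QEC.Census.CSS.K1LP16CertsB8X1
import Summits.Ventures.QEC.Census.CSS.K1LP16CertsB8X2
import Summits.Ventures.QEC.Census.CSSNormalFormInfoSet
import HarnessLib

/-!
# Cell `(16, 1)` CLOSED by linear programming: no CSS `[[16, 1, 5]]` code (`min (d^X, d^Z) ≤ 4` for every CSS code on 16 qubits with `k = 1`)

LADDER-QEC (venture cell `qec`), CENSUS-PREREG C.2 extension `13 ≤ n ≤ 16`, cell `(16, 1)` — the last cell of the optimal-CSS table `n ≤ 16`.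
KERNEL LOWER bound `4` (`[[16,1,4]]`, `Census/CSS/CalibCSSN16P1.lean`); this file is the KERNEL UPPER bound `≤ 4` by the type-10 route
(SPLIT LINEAR PROGRAMS of the `k = 1` normal form; 0 kit, no SAT): qec-type-02 g6's LRAT route (`Census/CSSNormalFormSAT/*`) is an independent
second kernel method for the same cell.

PROOF. Let `C` be a CSS code on 16 qubits with `k = 1`, `d^Z ≥ 5`, `d^X ≥ 5`.
1. `rank H^Z ∈ {7, 8}` (`CSS.css_16_1_5_rankZ`, `Census/CSS/K1LP16.lean`); w.l.o.g. `rank H^Z = 8`, `rank H^X = 7` (else pass to `C.swap`).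
2. `d^X ≥ 7`. Take a MINIMUM-weight `X`-logical `x` (`|x| = d^X`). No nonzero `X`-stabilizer lies inside `supp x` (it would give a lighter logical,
   `CSSNormalForm.restrict_injective_of_minWeight`), so `rs H^X` has an information set `I' ⊆ (supp x)ᶜ`, `|I'| = 7`
   (`exists_infoSet_subset`, `card_eq_rank_of_bij`); in the systematic form of `rs H^X` on `I'` (`rowSpZ_reindex_eq_sysCode_of_bij` applied to
   `C.swap`) the `k = 1` normal form (`CSSNormalForm.normalForm_of_sysCode`) has translate `s'` with `(0, s') = x` (two logicals of a `k = 1` code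
   differ by a stabilizer, `index_two`), so `wt s' = d^X`. The mirror split program `(b, w) = (7, d^X)` at distance `5` must then be FEASIBLE
   (`CSSK1LP.false_of_farkasCheck`); it is INFEASIBLE at `w = 5, 6` (`Census/CSS/K1LP16CertsB7.lean`). Hence `d^X ∉ {5, 6}`: `d^X ≥ 7`.
3. With `d^X ≥ 7`: the normal form of `C` itself (`CSSNormalForm.exists_normalForm`, `rank H^Z = 8`, translate weight `w ∈ [5, 8]`) must make the
   TWO-threshold split program `k1Rows₂ 8 w (8 − w) 5 7` feasible (`CSSK1LP.false_of_farkasCheck₂`); it is infeasible at every `w`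
   (`Census/CSS/K1LP16CertsB8X1/2.lean`). Contradiction.
RESULT: `css_16_1_lt_five` / `cssUpperLP_16_1'` — cell `(16, 1)` of the optimal-CSS table is `4` in the CERTIFIED column (KERNEL both bounds).
Tier KERNEL-std: every certificate `decide +kernel`, axioms standard, no `native_decide`. HONEST FRAMING: pure LP relaxations + linear algebra; the
distance `4` itself is the landed instance. [folklore] (weak LP duality, information sets, case analysis on the rank).
-/

namespace Summit.Ventures.QEC.Census.CSS

open Finset Matrix Summit.Ventures.QEC.Census Summit.Ventures.QEC.Census.CSSK1LP Summit.Ventures.QEC.Census.CSSNormalForm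
  Literature.InformationTheory.QuantumCodes Literature.InformationTheory.Coding

variable {RX RZ : Type*} [Fintype RX] [Fintype RZ]

/-- In `𝔽₂`, `a + b = 0 → b = a`. [folklore] -/
private theorem eq_of_add_eq_zero₂ : ∀ a b : ZMod 2, a + b = 0 → b = a := by decide

/-- STEP 2: a CSS `[[16,1]]` code with `rank H^Z = 8`, `d^Z ≥ 5`, `d^X ≥ 5` has `d^X ≥ 7` (mirror split program at the translate of a
minimum-weight `X`-logical). [folklore] -/
theorem seven_le_dX (C : CSSCode RX RZ (Fin 16)) (hk : C.k = 1) (h8 : C.HZ.rank = 8) (hZ : 5 ≤ C.dZ) (hX : 5 ≤ C.dX) : 7 ≤ C.dX := by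
  classical
  have hrX : C.HX.rank = 7 := by
    have h1 := C.k_eq; have h2 := C.rank_HX_add_rank_HZ_le
    rw [Fintype.card_fin] at h1 h2; omega
  -- a minimum-weight X-logical
  obtain ⟨x, hx0, hx1, hxw⟩ := C.exists_hammingNorm_eq_dX ((C.dX_pos_iff).1 (by omega))
  -- the swapped code D: its Z-side is C's X-side
  set D := C.swap with hD
  have hDx0 : D.HX *ᵥ x = 0 := hx0
  have hDx1 : x ∉ D.rowSpZ := hx1
  have hDmin : hammingNorm x = D.dZ := by rw [hD, CSSCode.dZ_swap]; exact hxw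
  have hinj := restrict_injective_of_minWeight D hDx0 hDx1 hDmin
  set T : Finset (Fin 16) := univ.filter fun q => x q = 0 with hT
  have hinjT : ∀ z ∈ rowSpace C.HX, (∀ q ∈ T, z q = 0) → z = 0 := fun z hz hzT =>
    hinj z hz (fun q hq => hzT q (by rw [hT, Finset.mem_filter]; exact ⟨Finset.mem_univ _, hq⟩))
  obtain ⟨I', hI'T, hbij⟩ := exists_infoSet_subset C.HX T hinjT
  have hcard : I'.card = 7 := by rw [card_eq_rank_of_bij C.HX I' hbij, hrX]
  have hxI : ∀ i : {q // q ∈ I'}, x i.1 = 0 := fun i => by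
    have := hI'T i.2; rw [hT, Finset.mem_filter] at this; exact this.2
  obtain ⟨A', hsys⟩ := rowSpZ_reindex_eq_sysCode_of_bij D I' hbij
  set D' := D.reindex (Equiv.refl RZ) (Equiv.refl RX) (Equiv.sumCompl fun q => q ∈ I').symm with hD'
  have hkD' : D'.k = 1 := by rw [hD', CSSCode.reindex_k, hD, CSSCode.k_swap]; exact hk
  obtain ⟨s', -, hZlog, hXlog⟩ := normalForm_of_sysCode D' hsys hkD'
  -- x, transported, is a Z-logical of D' vanishing on the information block; hence it is (0, s')
  set x' : {q // q ∈ I'} ⊕ {q // q ∉ I'} → ZMod 2 := x ∘ (Equiv.sumCompl fun q => q ∈ I') with hx'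
  have hx'comp : x' ∘ (Equiv.sumCompl fun q => q ∈ I').symm = x := by
    rw [hx']; funext q; simp
  have hx'log : D'.HX *ᵥ x' = 0 ∧ x' ∉ D'.rowSpZ := by
    rw [hD', CSSCode.zLogical_reindex_iff, hx'comp]; exact ⟨hDx0, hDx1⟩
  have hy := hZlog 0
  rw [Matrix.zero_vecMul, zero_add] at hy
  have hsum := index_two D' hkD' hx'log.1 hx'log.2 hy.1 hy.2
  rw [hsys, mem_sysCode_iff] at hsum
  have hs'x : ∀ j : {q // q ∉ I'}, s' j = x j.1 := by
    intro j
    have h := hsum j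
    have hzero : ∀ i : {q // q ∈ I'}, (x' + Sum.elim (0 : {q // q ∈ I'} → ZMod 2) s') (Sum.inl i) = 0 := fun i => by
      simp [hx', hxI i]
    simp only [hzero, zero_mul, Finset.sum_const_zero] at h
    have h' : x j.1 + s' j = 0 := by simpa [hx'] using h
    exact eq_of_add_eq_zero₂ _ _ h'
  have hwt : hammingNorm s' = C.dX := by
    rw [← hxw]
    have hxe : x = Sum.elim (fun i : {q // q ∈ I'} => x i.1) (fun j : {q // q ∉ I'} => x j.1) ∘ (Equiv.sumCompl fun q => q ∈ I').symm := by
      funext q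
      by_cases hq : q ∈ I'
      · simp [Equiv.sumCompl_symm_apply_of_pos hq]
      · simp [Equiv.sumCompl_symm_apply_of_neg hq]
    have hs'fun : s' = fun j : {q // q ∉ I'} => x j.1 := funext hs'x
    rw [hxe, hammingNorm_comp_equiv, hammingNorm_sumElim, hs'fun]
    have h0 : (fun i : {q // q ∈ I'} => x i.1) = 0 := funext hxI
    rw [h0, hammingNorm_zero, zero_add]
  -- the split-weight hypotheses of the mirror program at (7, d^X)
  set S := (univ : Finset {q // q ∉ I'}).filter fun q => s' q ≠ 0 with hS
  have hSw : #S = C.dX := by rw [← hwt]; rfl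
  have hκ : Fintype.card {q // q ∈ I'} = 7 := by rw [Fintype.card_coe, hcard]
  have hμ : Fintype.card {q // q ∉ I'} = 9 := by rw [Fintype.card_subtype_compl, Fintype.card_coe, hcard, Fintype.card_fin]
  have hSc : #Sᶜ = 9 - C.dX := by rw [Finset.card_compl, hμ, hSw]
  have hD'Z : D'.dZ = C.dX := by rw [hD', CSSCode.reindex_dZ, hD, CSSCode.dZ_swap]
  have hD'X : D'.dX = C.dZ := by rw [hD', CSSCode.reindex_dX, hD, CSSCode.dX_swap]
  have hZ' : ∀ v : {q // q ∈ I'} → ZMod 2, 5 ≤ wtOn univ v + (#S - wtOn S (v ᵥ* A')) + wtOn Sᶜ (v ᵥ* A') := by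
    intro v
    have h := D'.dZ_le_hammingNorm (hZlog v).1 (hZlog v).2
    rw [hammingNorm_sumElim, hD'Z, hammingNorm_add_eq s' (v ᵥ* A'), ← hS, ← wtOn_univ] at h
    omega
  have hX' : ∀ u : {q // q ∉ I'} → ZMod 2, wtOn S u % 2 = 1 → 5 ≤ wtOn univ u + wtOn univ (A' *ᵥ u) := by
    intro u hu
    have hus := dotProduct_eq_one_of_wtOn s' u hu
    have h := D'.dX_le_hammingNorm (hXlog u hus).1 (hXlog u hus).2
    rw [hammingNorm_sumElim, hammingNorm_neg', hD'X, ← wtOn_univ, ← wtOn_univ] at h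
    omega
  -- d^X = 5 and d^X = 6 are LP-infeasible
  by_contra hlt
  have hcases : C.dX = 5 ∨ C.dX = 6 := by omega
  rcases hcases with h5 | h6
  · exact false_of_farkasCheck A' S k1cert_16_7_5 hκ (by rw [hSw, h5]) (by rw [hSc, h5]) hZ' hX'
  · exact false_of_farkasCheck A' S k1cert_16_7_6 hκ (by rw [hSw, h6]) (by rw [hSc, h6]) hZ' hX'

/-- STEPS 1–3 at `rank H^Z = 8`: contradiction. [folklore] -/
theorem false_of_rank8 (C : CSSCode RX RZ (Fin 16)) (hk : C.k = 1) (h8 : C.HZ.rank = 8) (hZ : 5 ≤ C.dZ) (hX : 5 ≤ C.dX) : False := by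
  classical
  have h7 := seven_le_dX C hk h8 hZ hX
  obtain ⟨I, A, s, hI, -, hZn, hXn⟩ := exists_normalForm C hk
  set S := (univ : Finset {q // q ∉ I}).filter fun q => s q ≠ 0 with hS
  have hκ : Fintype.card {q // q ∈ I} = 8 := by rw [Fintype.card_coe, hI, h8]
  have hμ : Fintype.card {q // q ∉ I} = 8 := by rw [Fintype.card_subtype_compl, Fintype.card_coe, hI, h8, Fintype.card_fin]
  have hw5 : 5 ≤ #S := by
    have h := hZn 0
    rw [Matrix.zero_vecMul, zero_add, hammingNorm_zero, zero_add] at h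
    exact hZ.trans h
  have hw8 : #S ≤ 8 := (card_filter_le _ _).trans ((card_univ (α := {q // q ∉ I})).le.trans hμ.le)
  have hSc : #Sᶜ = 8 - #S := by rw [Finset.card_compl, hμ]
  have hZ' : ∀ v : {q // q ∈ I} → ZMod 2, 5 ≤ wtOn univ v + (#S - wtOn S (v ᵥ* A)) + wtOn Sᶜ (v ᵥ* A) := by
    intro v
    have h := hZ.trans (hZn v)
    rw [hammingNorm_add_eq s (v ᵥ* A), ← hS, ← wtOn_univ] at h
    omega
  have hX' : ∀ u : {q // q ∉ I} → ZMod 2, wtOn S u % 2 = 1 → 7 ≤ wtOn univ u + wtOn univ (A *ᵥ u) := by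
    intro u hu
    have h := h7.trans (hXn u (dotProduct_eq_one_of_wtOn s u hu))
    rwa [← wtOn_univ, ← wtOn_univ] at h
  have hcases : #S = 5 ∨ #S = 6 ∨ #S = 7 ∨ #S = 8 := by omega
  rcases hcases with h | h | h | h
  · exact false_of_farkasCheck₂ A S k1certX_16_8_5 hκ h (by rw [hSc, h]) hZ' hX'
  · exact false_of_farkasCheck₂ A S k1certX_16_8_6 hκ h (by rw [hSc, h]) hZ' hX'
  · exact false_of_farkasCheck₂ A S k1certX_16_8_7 hκ h (by rw [hSc, h]) hZ' hX'
  · exact false_of_farkasCheck₂ A S k1certX_16_8_8 hκ h (by rw [hSc, h]) hZ' hX'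

/-- ★★ **No CSS `[[16, 1, 5]]` code**: every CSS code on `16` qubits with one logical qubit has `d^Z ≤ 4` or `d^X ≤ 4`. [folklore] -/
theorem css_16_1_lt_five (C : CSSCode RX RZ (Fin 16)) (hk : C.k = 1) : ¬ (5 ≤ C.dZ ∧ 5 ≤ C.dX) := by
  rintro ⟨hZ, hX⟩
  rcases css_16_1_5_rankZ C hk hZ hX with h7 | h8
  · -- rank H^Z = 7: the swapped code has rank H^Z = 8
    have hsum : C.HX.rank + C.HZ.rank = 15 := by
      have h1 := C.k_eq; have h2 := C.rank_HX_add_rank_HZ_le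
      rw [Fintype.card_fin] at h1 h2; omega
    refine false_of_rank8 C.swap (by rw [CSSCode.k_swap]; exact hk) ?_ (by rw [CSSCode.dZ_swap]; exact hX)
      (by rw [CSSCode.dX_swap]; exact hZ)
    rw [CSSCode.swap_HZ]; omega
  · exact false_of_rank8 C hk h8 hZ hX

/-- **Cell `(16, 1)` of the optimal-CSS table, census form** (the statement shape of `CSS16-UPPER-CELLS.tsv`): `min (d^X, d^Z) ≤ 4` for every
CSS code on 16 qubits with `k = 1` — so the optimal CSS distance at `(16, 1)` is EXACTLY `4` (instance `[[16,1,4]]` landed), KERNEL in both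
columns. [folklore] -/
theorem cssUpperSplitLP_16_1 (C : CSSCode RX RZ (Fin 16)) (hk : C.k = 1) : min C.dX C.dZ ≤ 4 := by
  have h := css_16_1_lt_five C hk
  by_contra hlt
  push Not at hlt
  exact h ⟨by omega, by omega⟩

end Summit.Ventures.QEC.Census.CSS
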